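import Literature.AlgebraicGeometry.Motives.JacobianHomology
import HarnessLib

/-!
# Complex points are dense for the constructible topology: opens containing all complex points

For a scheme `T` locally of finite type over `ℂ`, the underlying space is Jacobson and its closed
points are exactly the points `P.pt` of complex points `P ∈ T(ℂ)` (Nullstellensatz;
`ComplexPoints.equivClosedPoints`). Hence:

* `isOpen_eq_univ_of_forall_pt_mem`: an open subset of `T` containing every `P.pt` is everything (its
  closed complement has no closed point);
* `surjective_of_forall_exists_map_eq`: a morphism `p : Z ⟶ T` of `ℂ`-schemes locally of finite type
  with open image (e.g. flat of finite presentation, an open immersion) which is surjective on complex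
  points is surjective;
* `isIso_left_of_isOpenImmersion_of_surjective_map`: an open immersion surjective on complex points is
  an isomorphism.

(Görtz–Wedhorn I, Prop. 3.35: for `X` locally of finite type over a field the closed points are very
dense.) Everything is proved.

## References

* U. Görtz, T. Wedhorn, *Algebraic Geometry I*, 2nd ed. (2020), Prop. 3.35. [GortzWedhorn2020]
-/

noncomputable section

open CategoryTheory AlgebraicGeometry

namespace Literature.AlgebraicGeometry.Motives

/-- **An open subset containing all complex points is everything** (`T` locally of finite type over
`ℂ`): its closed complement would contain a closed point (Jacobson), i.e. the point of a complex point.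
[cite: GortzWedhorn2020, Prop. 3.35] -/
theorem isOpen_eq_univ_of_forall_pt_mem {T : SchemeOver ℂ} [LocallyOfFiniteType T.hom]
    {U : Set T.left} (hU : IsOpen U) (h : ∀ P : ComplexPoints T, P.pt ∈ U) : U = Set.univ := by
  haveI : JacobsonSpace ↥T.left := LocallyOfFiniteType.jacobsonSpace T.hom
  by_contra hne
  have hc : (Uᶜ).Nonempty := Set.nonempty_compl.mpr hne
  obtain ⟨x, hxU, hxc⟩ := nonempty_inter_closedPoints (X := ↥T.left) hc
    (hU.isClosed_compl.isLocallyClosed)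
  have hP := h ((ComplexPoints.equivClosedPoints T).symm ⟨x, hxc⟩)
  have hpt : ((ComplexPoints.equivClosedPoints T).symm ⟨x, hxc⟩).pt = x := by
    have := ComplexPoints.coe_equivClosedPoints_apply T ((ComplexPoints.equivClosedPoints T).symm ⟨x, hxc⟩)
    rw [Equiv.apply_symm_apply] at this
    exact this.symm
  rw [hpt] at hP
  exact hxU hP

/-- **A morphism with open image which is onto on complex points is surjective** (`ℂ`-schemes locally
of finite type). [cite: GortzWedhorn2020, Prop. 3.35] -/
theorem surjective_of_forall_exists_map_eq {Z T : SchemeOver ℂ} (p : Z ⟶ T) [LocallyOfFiniteType T.hom]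
    (hopen : IsOpen (Set.range p.left)) (h : ∀ Q : ComplexPoints T, ∃ P : ComplexPoints Z,
      AlgPoints.map (L := ℂ) p P = Q) : Surjective p.left := by
  refine ⟨fun y => ?_⟩
  have huniv := isOpen_eq_univ_of_forall_pt_mem (T := T) hopen fun Q => by
    obtain ⟨P, rfl⟩ := h Q
    exact ⟨P.pt, (AlgPoints.pt_map p P).symm⟩
  have : y ∈ Set.range p.left := by rw [huniv]; trivial
  exact this

/-- **An open immersion of `ℂ`-schemes which is onto on complex points is an isomorphism** (of
underlying schemes). [cite: GortzWedhorn2020, Prop. 3.35] -/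
theorem isIso_left_of_isOpenImmersion_of_surjective_map {Z T : SchemeOver ℂ} (p : Z ⟶ T)
    [LocallyOfFiniteType T.hom] [IsOpenImmersion p.left]
    (h : Function.Surjective (AlgPoints.map (L := ℂ) p)) : IsIso p.left := by
  rw [isIso_iff_isOpenImmersion_and_surjective]
  exact ⟨inferInstance, surjective_of_forall_exists_map_eq p p.left.isOpenEmbedding.isOpen_range
    fun Q => h Q⟩

/-- An `Over`-morphism whose underlying morphism of schemes is an isomorphism is an isomorphism.
[folklore] -/
theorem isIso_of_isIso_left {k : Type} [Field k] {Z T : SchemeOver k} (p : Z ⟶ T) [IsIso p.left] :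
    IsIso p :=
  haveI : IsIso ((Over.forget (Spec (CommRingCat.of k))).map p) := ‹IsIso p.left›
  isIso_of_reflects_iso p (Over.forget _)

end Literature.AlgebraicGeometry.Motives

end
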